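import Summits.AtomisticToContinuum.Crystallization.Theses.SymmetryRankLadder
import Summits.AtomisticToContinuum.Crystallization.Theorems.PricedLinkCensusStackingHingeHcpEnergyMinOnBox

/-!
# Crux workfile — `TransverseCompactness` (stmt-AtomisticToContinuum-5831): where the crux sits

Crux-strategist r1 (REDIRECT, likely-fail scan 2026-08-17), route `SymmetryRankLadder`.  Sorry-free
structure theorems quoted in `STRATEGY-CENSUS.md`:

* `InB Q` — the output class `B` of the crux (hard core `1/2`, two linearly independent periods of
  length `≤ 6/5`); `TransverseCompactness ↔ ∀ Q, ∃ Q', e Q' ≤ e Q ∧ InB Q'` is `Iff.rfl`.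
* `inB_hcp` — every relaxed hcp of the box `B₀ = [47/50,1] × [39a/50, 17a/20]` lies in `B`.
* `transverseCompactness_of_hcpPeriodicMinimiser` — **the route's TARGET implies the crux**
  (`X → C`): the crux is a consequence of the statement it is meant to help prove.
* `transverseCompactness_iff_isLeast_inB` — granted attainment INSIDE `B` (`AttainedInB`), the crux is
  EQUIVALENT to "some configuration of `B` is a least element of `e` over ALL periodic configurations",
  i.e. to the attainment-and-location half of conjunct (i) of the summit.
* `attainedInB_of_tail` — `AttainedInB` is exactly what the route's two lower-rank cruxes
  (`TriangularLayering`, `MonolayerStackOptimality`) deliver, `HcpEnergyMinOnBox` being a theorem.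
* `costume` — hence, granted those two cruxes, `TransverseCompactness ↔ HcpPeriodicMinimiser`, and
  `conjunct_i_of_hcpPeriodicMinimiser : HcpPeriodicMinimiser → HasPeriodicGroundStateEnergy V_LJ 3`
  (conjunct (i) of `Crystallization`, using the landed `crysEnergyLimit_proof`, item 0626).
* `not_transverseCompactness_iff` — the negation is a periodic configuration STRICTLY below every
  member of `B` (below every relaxed hcp, fcc, Barlow stacking, bcc, …): a new Lennard-Jones ground
  state outside the close-packed family.

All `[folklore]`; the only definitions are the two abbreviations `InB`, `AttainedInB`.
-/

namespace Summit.AtomisticToContinuum.Crystallization.Cruxes.TransverseCompactness.Costume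

open Literature.MathematicalPhysics.StatisticalMechanics
open Summit.AtomisticToContinuum.Crystallization.Theses.SymmetryRankLadder

noncomputable section

/-- The output class `B` of the crux: hard core `1/2` and two linearly independent periods of
length `≤ 6/5`. [folklore] -/
def InB (Q : PeriodicConfiguration 3) : Prop :=
  (∀ x ∈ Q.points, ∀ y ∈ Q.points, x ≠ y → (1 / 2 : ℝ) ≤ dist x y) ∧
    (∃ u ∈ Q.lattice, ∃ v ∈ Q.lattice, LinearIndependent ℝ ![u, v] ∧ ‖u‖ ≤ 6 / 5 ∧ ‖v‖ ≤ 6 / 5)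

/-- Attainment of the Lennard-Jones energy per particle INSIDE the class `B`. [folklore] -/
def AttainedInB : Prop :=
  ∃ P : PeriodicConfiguration 3, InB P ∧
    ∀ Q : PeriodicConfiguration 3, InB Q → P.energyPerParticle lennardJones ≤ Q.energyPerParticle lennardJones

/-- The crux, read through `InB` (definitional). [folklore] -/
theorem transverseCompactness_iff :
    TransverseCompactness ↔ ∀ Q : PeriodicConfiguration 3, ∃ Q' : PeriodicConfiguration 3,
      Q'.energyPerParticle lennardJones ≤ Q.energyPerParticle lennardJones ∧ InB Q' :=
  Iff.rfl

/-! ## hcp of the box lies in `B` -/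

/-- `‖(a, 0, 0)‖ = |a|`. [folklore] -/
theorem norm_triangularVec₁ (a : ℝ) : ‖triangularVec₁ a‖ = |a| := by
  rw [EuclideanSpace.norm_eq, Fin.sum_univ_three]
  simp [triangularVec₁, Real.sqrt_sq_eq_abs]

/-- `‖(a/2, a√3/2, 0)‖ = |a|`. [folklore] -/
theorem norm_triangularVec₂ (a : ℝ) : ‖triangularVec₂ a‖ = |a| := by
  rw [EuclideanSpace.norm_eq, Fin.sum_univ_three]
  have h3 : (√3 : ℝ) ^ 2 = 3 := Real.sq_sqrt (by norm_num)
  have : (a / 2) ^ 2 + (a * √3 / 2) ^ 2 + (0 : ℝ) ^ 2 = a ^ 2 := by nlinarith [h3]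
  simp only [triangularVec₂, PiLp.toLp_apply, Matrix.cons_val_zero, Matrix.cons_val_one,
    Matrix.cons_val, Real.norm_eq_abs, sq_abs]
  rw [this, Real.sqrt_sq_eq_abs]

/-- `u = (a,0,0)` and `v = (a/2, a√3/2, 0)` are linearly independent for `a ≠ 0`. [folklore] -/
theorem linearIndependent_triangularVec {a : ℝ} (ha : a ≠ 0) :
    LinearIndependent ℝ ![triangularVec₁ a, triangularVec₂ a] := by
  rw [LinearIndependent.pair_iff]
  intro s t hst
  have e1 := congrArg (fun x : EuclideanSpace ℝ (Fin 3) => x 1) hst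
  have e0 := congrArg (fun x : EuclideanSpace ℝ (Fin 3) => x 0) hst
  simp only [PiLp.add_apply, PiLp.smul_apply, PiLp.zero_apply, triangularVec₁, triangularVec₂,
    smul_eq_mul] at e0 e1
  simp only [PiLp.toLp_apply, Matrix.cons_val_zero, Matrix.cons_val_one, Matrix.cons_val,
    mul_zero, zero_add] at e0 e1
  have h3 : (0 : ℝ) < √3 := by positivity
  have ht : t = 0 := by
    have h' : t * a * √3 = 0 := by linarith
    rcases mul_eq_zero.1 h' with h'' | h''
    · rcases mul_eq_zero.1 h'' with h4 | h4
      · exact h4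
      · exact absurd h4 ha
    · exact absurd h'' h3.ne'
  subst ht
  have hs : s = 0 := by
    have : s * a = 0 := by linarith
    rcases mul_eq_zero.1 this with h | h
    · exact h
    · exact absurd h ha
  exact ⟨hs, rfl⟩

/-- The layer generators are periods of `hcpPeriodicConfiguration`. [folklore] -/
theorem triangularVec_mem_hcp_lattice {a h : ℝ} (ha : a ≠ 0) (hh : h ≠ 0) :
    triangularVec₁ a ∈ (hcpPeriodicConfiguration ha hh).lattice ∧
      triangularVec₂ a ∈ (hcpPeriodicConfiguration ha hh).lattice := by
  have h1 := sum_smul_mem_barlowPeriodLattice alternatingHagg ha hh two_ne_zero 1 0 0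
  have h2 := sum_smul_mem_barlowPeriodLattice alternatingHagg ha hh two_ne_zero 0 1 0
  simp only [Int.cast_one, Int.cast_zero, one_smul, zero_smul, add_zero, zero_add] at h1 h2
  exact ⟨h1, h2⟩

/-- **Every relaxed hcp of the box lies in `B`**: hard core `min a h ≥ 0.733 ≥ 1/2` and periods
`‖u‖ = ‖v‖ = a ≤ 1 ≤ 6/5`. [folklore] -/
theorem inB_hcp {a h : ℝ} (ha : a ≠ 0) (hh : h ≠ 0) (h₁ : 47 / 50 ≤ a) (h₂ : a ≤ 1)
    (h₃ : 39 / 50 * a ≤ h) (_h₄ : h ≤ 17 / 20 * a) : InB (hcpPeriodicConfiguration ha hh) := by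
  have ha0 : 0 ≤ a := by linarith
  have hh0 : 0 ≤ h := by linarith
  refine ⟨?_, ?_⟩
  · intro x hx y hy hxy
    rw [hcpPeriodicConfiguration_points] at hx hy
    have hmin := le_dist_of_mem_barlowStacking a h alternatingHagg ha0 hh0 hx hy hxy
    have : (1 / 2 : ℝ) ≤ min a h := le_min (by linarith) (by linarith)
    exact this.trans hmin
  · obtain ⟨hu, hv⟩ := triangularVec_mem_hcp_lattice ha hh
    refine ⟨_, hu, _, hv, linearIndependent_triangularVec ha, ?_, ?_⟩
    · rw [norm_triangularVec₁, abs_of_nonneg ha0]; linarith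
    · rw [norm_triangularVec₂, abs_of_nonneg ha0]; linarith

/-! ## The crux against the target and against conjunct (i) -/

/-- A least element of `e` over all periodic configurations that lies in `B` gives the crux
(take `Q' :=` that element for every `Q`). [folklore] -/
theorem transverseCompactness_of_isLeast_inB
    (hP : ∃ P : PeriodicConfiguration 3, InB P ∧
      IsLeast (Set.range fun Q : PeriodicConfiguration 3 => Q.energyPerParticle lennardJones)
        (P.energyPerParticle lennardJones)) :
    TransverseCompactness := by
  obtain ⟨P, hPB, hleast⟩ := hP
  intro Q
  exact ⟨P, hleast.2 ⟨Q, rfl⟩, hPB.1, hPB.2⟩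

/-- **`X → C`: the route's target implies the crux.** [folklore] -/
theorem transverseCompactness_of_hcpPeriodicMinimiser :
    HcpPeriodicMinimiser → TransverseCompactness := by
  rintro ⟨a, h, ha, hh, h₁, h₂, h₃, h₄, hleast⟩
  exact transverseCompactness_of_isLeast_inB ⟨_, inB_hcp ha hh h₁ h₂ h₃ h₄, hleast⟩

/-- Granted attainment inside `B`, the crux makes the `B`-minimiser a GLOBAL periodic minimiser.
[folklore] -/
theorem isLeast_inB_of_transverseCompactness (hB : AttainedInB) (hC : TransverseCompactness) :
    ∃ P : PeriodicConfiguration 3, InB P ∧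
      IsLeast (Set.range fun Q : PeriodicConfiguration 3 => Q.energyPerParticle lennardJones)
        (P.energyPerParticle lennardJones) := by
  obtain ⟨P, hPB, hmin⟩ := hB
  refine ⟨P, hPB, ⟨P, rfl⟩, ?_⟩
  rintro _ ⟨Q, rfl⟩
  obtain ⟨Q', hle, hcore, hper⟩ := hC Q
  exact (hmin Q' ⟨hcore, hper⟩).trans hle

/-- **The crux relativises conjunct (i) to the class `B`**: granted attainment inside `B`,
`TransverseCompactness ↔` "a configuration of `B` minimises `e` over ALL periodic configurations".
[folklore] -/
theorem transverseCompactness_iff_isLeast_inB (hB : AttainedInB) :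
    TransverseCompactness ↔ ∃ P : PeriodicConfiguration 3, InB P ∧
      IsLeast (Set.range fun Q : PeriodicConfiguration 3 => Q.energyPerParticle lennardJones)
        (P.energyPerParticle lennardJones) :=
  ⟨isLeast_inB_of_transverseCompactness hB, transverseCompactness_of_isLeast_inB⟩

/-- Attainment of the periodic infimum gives conjunct (i) of `Crystallization`, the limit
`E(N)/N → ⨅ e` being the landed item 0626 (`crysEnergyLimit_proof`). [folklore] -/
theorem conjunct_i_of_isLeast
    (h : ∃ P : PeriodicConfiguration 3,
      IsLeast (Set.range fun Q : PeriodicConfiguration 3 => Q.energyPerParticle lennardJones)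
        (P.energyPerParticle lennardJones)) :
    HasPeriodicGroundStateEnergy lennardJones 3 := by
  obtain ⟨P, hP⟩ := h
  refine ⟨P, hP, ?_⟩
  have hlim : Filter.Tendsto (fun N : ℕ => groundStateEnergy lennardJones 3 N / N) Filter.atTop
      (nhds (⨅ Q : PeriodicConfiguration 3, Q.energyPerParticle lennardJones)) :=
    Summit.AtomisticToContinuum.Crystallization.Theorems.crysEnergyLimit_proof
  have hinf : (⨅ Q : PeriodicConfiguration 3, Q.energyPerParticle lennardJones) =
      P.energyPerParticle lennardJones := hP.csInf_eq
  rw [hinf] at hlim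
  exact hlim

/-- **The target is at least conjunct (i).** [folklore] -/
theorem conjunct_i_of_hcpPeriodicMinimiser :
    HcpPeriodicMinimiser → HasPeriodicGroundStateEnergy lennardJones 3 := by
  rintro ⟨a, h, ha, hh, -, -, -, -, hleast⟩
  exact conjunct_i_of_isLeast ⟨_, hleast⟩

/-- Conversely, conjunct (i) together with "some global periodic minimiser is matched inside `B`"
gives the crux. [folklore] -/
theorem transverseCompactness_of_conjunct_i
    (hi : HasPeriodicGroundStateEnergy lennardJones 3)
    (hloc : ∀ P : PeriodicConfiguration 3,
      IsLeast (Set.range fun Q : PeriodicConfiguration 3 => Q.energyPerParticle lennardJones)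
        (P.energyPerParticle lennardJones) →
      ∃ P' : PeriodicConfiguration 3, InB P' ∧
        P'.energyPerParticle lennardJones ≤ P.energyPerParticle lennardJones) :
    TransverseCompactness := by
  obtain ⟨P, hleast, -⟩ := hi
  obtain ⟨P', hP'B, hle⟩ := hloc P hleast
  intro Q
  exact ⟨P', hle.trans (hleast.2 ⟨Q, rfl⟩), hP'B.1, hP'B.2⟩

/-! ## Inside the route: granted the two lower-rank cruxes, the crux IS the target -/

/-- `HcpEnergyMinOnBox` (stmt-3066) is a theorem: shared verbatim with
`PoissonBesselStacking.HcpEnergyMinOnBox`, landed as `PricedHcpWindowsHcpBox.stub_hcpEnergyMinOnBox`.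
[folklore] -/
theorem hcpEnergyMinOnBox_proof : HcpEnergyMinOnBox :=
  Summit.AtomisticToContinuum.Crystallization.Theorems.PricedHcpWindowsHcpBox.stub_hcpEnergyMinOnBox

/-- The route's rank-3/4 cruxes deliver attainment inside `B` (at the box minimiser of hcp).
[folklore] -/
theorem attainedInB_of_tail (hL2 : TriangularLayering) (hS2 : MonolayerStackOptimality) :
    AttainedInB := by
  obtain ⟨a₀, h₀, ha₀, hh₀, hB₁, hB₂, hB₃, hB₄, hmin⟩ := hcpEnergyMinOnBox_proof
  refine ⟨hcpPeriodicConfiguration ha₀ hh₀, inB_hcp ha₀ hh₀ hB₁ hB₂ hB₃ hB₄, ?_⟩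
  rintro Q ⟨hcore, hper⟩
  obtain ⟨Q₂, hQ₂, a, ha₁, ha₂, hu, hv, hlayer, hgap, hnext⟩ := hL2 Q hcore hper
  obtain ⟨a', h, ha', hh, hb₁, hb₂, hb₃, hb₄, hhcp⟩ :=
    hS2 Q₂ a ha₁ ha₂ ⟨hu, hv, hlayer, hgap, hnext⟩
  calc (hcpPeriodicConfiguration ha₀ hh₀).energyPerParticle lennardJones
      ≤ (hcpPeriodicConfiguration ha' hh).energyPerParticle lennardJones :=
        hmin a' h ha' hh hb₁ hb₂ hb₃ hb₄
    _ ≤ Q₂.energyPerParticle lennardJones := hhcp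
    _ ≤ Q.energyPerParticle lennardJones := hQ₂

/-- The assembly direction (`C ∧ tail → X`), as in `Cruxes/HcpPeriodicMinimiser/SplitAssembly.lean`.
[folklore] -/
theorem hcpPeriodicMinimiser_of_transverseCompactness (hL2 : TriangularLayering)
    (hS2 : MonolayerStackOptimality) (hC2 : TransverseCompactness) : HcpPeriodicMinimiser := by
  obtain ⟨a₀, h₀, ha₀, hh₀, hB₁, hB₂, hB₃, hB₄, hmin⟩ := hcpEnergyMinOnBox_proof
  refine ⟨a₀, h₀, ha₀, hh₀, hB₁, hB₂, hB₃, hB₄, Set.mem_range_self _, ?_⟩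
  rintro _ ⟨Q, rfl⟩
  obtain ⟨Q₁, hQ₁, hcore, hper⟩ := hC2 Q
  obtain ⟨Q₂, hQ₂, a, ha₁, ha₂, hu, hv, hlayer, hgap, hnext⟩ := hL2 Q₁ hcore hper
  obtain ⟨a', h, ha', hh, hb₁, hb₂, hb₃, hb₄, hhcp⟩ :=
    hS2 Q₂ a ha₁ ha₂ ⟨hu, hv, hlayer, hgap, hnext⟩
  calc (hcpPeriodicConfiguration ha₀ hh₀).energyPerParticle lennardJones
      ≤ (hcpPeriodicConfiguration ha' hh).energyPerParticle lennardJones :=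
        hmin a' h ha' hh hb₁ hb₂ hb₃ hb₄
    _ ≤ Q₂.energyPerParticle lennardJones := hhcp
    _ ≤ Q₁.energyPerParticle lennardJones := hQ₂
    _ ≤ Q.energyPerParticle lennardJones := hQ₁

/-- **COSTUME THEOREM.** Granted the route's own rank-3 and rank-4 cruxes (the pieces it calls
lower-dimensional), the rank-2 crux `TransverseCompactness` is EQUIVALENT to the route's target
`HcpPeriodicMinimiser`, which is at least conjunct (i) of the summit
(`conjunct_i_of_hcpPeriodicMinimiser`). [folklore] -/
theorem costume (hL2 : TriangularLayering) (hS2 : MonolayerStackOptimality) :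
    TransverseCompactness ↔ HcpPeriodicMinimiser :=
  ⟨hcpPeriodicMinimiser_of_transverseCompactness hL2 hS2,
    transverseCompactness_of_hcpPeriodicMinimiser⟩

/-- Same, phrased against conjunct (i): granted the tail, the crux implies conjunct (i) of
`Crystallization`. [folklore] -/
theorem conjunct_i_of_transverseCompactness (hL2 : TriangularLayering)
    (hS2 : MonolayerStackOptimality) (hC2 : TransverseCompactness) :
    HasPeriodicGroundStateEnergy lennardJones 3 :=
  conjunct_i_of_hcpPeriodicMinimiser (hcpPeriodicMinimiser_of_transverseCompactness hL2 hS2 hC2)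

/-! ## The negation -/

/-- **What a counterexample must be**: a periodic configuration strictly below EVERY member of
`B` — below every relaxed hcp, fcc, Barlow stacking, bcc, … — i.e. a new Lennard-Jones periodic
ground-state candidate outside the close-packed family. [folklore] -/
theorem not_transverseCompactness_iff :
    ¬ TransverseCompactness ↔ ∃ Q : PeriodicConfiguration 3, ∀ Q' : PeriodicConfiguration 3,
      InB Q' → Q.energyPerParticle lennardJones < Q'.energyPerParticle lennardJones := by
  simp only [transverseCompactness_iff, not_forall, not_exists, not_and', not_le]

end

end Summit.AtomisticToContinuum.Crystallization.Cruxes.TransverseCompactness.Costume
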